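import Summits.QuantumFields.YangMills.Theorems.TwistedTraceScaling.Negative.ConstProximityCentreTwist
import HarnessLib

/-!
# Tightness lemma R9 for crux `TwistedTraceScaling` (stmt-QuantumFields-20203): at ODD `L` a centre twist is a gauge transformation times the global centre
# flip of one direction — `Even L` is load-bearing in `R9.constProximity_rpow_false`

Standing disprover `ym-cdisprove-20203-1` (gen 9); boundary companion of `Negative/ConstProximityCentreTwist.lean`, whose refutation of «`S ≤ σ ⇒` modulo gauge all
links within `C·S^α` of a CONSTANT configuration» (`α > 1/4`) is stated for EVEN `L` and witnessed by the 't Hooft twist `twist 2 negOne (twoLinkCfg a_φ b_φ)`.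
Kernel-checked here: that restriction is not an artefact of the proof but of the witness —
* ★ `exists_gauge_twist_negOne_of_odd`: for ODD `L`, every `k` and EVERY configuration `U`, the twisted configuration `twist k negOne U` is a gauge transform
  of the configuration `U` with ALL direction-`k` links multiplied by the central `−1` (gauge function `x ↦ (−1)^{[x_k ∈ {2,4,…,L−1}]}`, which closes up around
  the circle exactly because `L − 1` is even);
* ★ `twist_twoLinkCfg_gauge_const_of_odd`: hence at odd `L` the R9 witness is EXACTLY gauge-equivalent to a constant configuration (`(a, b, −1)`): the distance
  «modulo gauge to the constants» vanishes and the witness refutes nothing — consistent with `Negative/ConstProximityCentreTwist.lean` needing `Even L`, and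
  with the REPAIRED text C3c′ of the Disproof workfile §L (proximity up to gauge AND centre twist), which at odd `L` reduces to proximity up to gauge and the
  finite flip group `c_k ↦ ± c_k` of the constants.
At even `L` no such gauge function exists (the direction-`k` Polyakov loop of `twist k negOne U` is `−1` times that of `U`, a gauge-INVARIANT difference
when the loop is non-zero: `R9.lineHolonomy_gauge_transform_period`); whether «`√σ`-close to the constants modulo gauge» HOLDS at odd `L` stays open.
## WHAT THIS IS NOT
Lattice bookkeeping at fixed `L` on the Negative/ lane (`--supports stmt-QuantumFields-20203`); not `¬TwistedTraceScaling`, no stub touched.  HONEST FRAMING: femto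
rung R2b1, stub support of a child of a CONDITIONAL reduction route; not a gap, not Clay.  Sorry-free, no new definition; axioms ⊆ {propext, Classical.choice, Quot.sound}.
-/

set_option autoImplicit false

noncomputable section

open Literature.MathematicalPhysics.QuantumFieldTheory hiding SU2
open Literature.MathematicalPhysics.QuantumLattice
open Summit.QuantumFields.YangMills.Theorems.FemtoTransferGap
open Summit.QuantumFields.YangMills.Theorems.FemtoTransferGap.PhysL2 (twoLinkCfg)

namespace Summit.QuantumFields.YangMills.Theorems.TwistedTraceScaling.Negative.R9

variable {L : ℕ} [NeZero L]

/-- Parity core: for odd `L`, `v < L` and `v' = (v + 1 % L) % L` (the successor residue), EXACTLY ONE of «`v` even and non-zero», «`v = 0`»,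
«`v'` even and non-zero» holds. [folklore] -/
private theorem parity_core (hL : Odd L) {v v' : ℕ} (hv : v < L) (hv' : v' = (v + 1 % L) % L) :
    ((v % 2 = 0 ∧ v ≠ 0) ∧ v ≠ 0 ∧ ¬ (v' % 2 = 0 ∧ v' ≠ 0)) ∨ (¬ (v % 2 = 0 ∧ v ≠ 0) ∧ v = 0 ∧ ¬ (v' % 2 = 0 ∧ v' ≠ 0)) ∨
      (¬ (v % 2 = 0 ∧ v ≠ 0) ∧ v ≠ 0 ∧ (v' % 2 = 0 ∧ v' ≠ 0)) := by
  obtain ⟨m, rfl⟩ := hL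
  rcases Nat.eq_zero_or_pos m with rfl | hm
  · -- `L = 1`
    have hv0 : v = 0 := by omega
    subst hv0
    norm_num at hv'
    omega
  · have h1 : 1 % (2 * m + 1) = 1 := Nat.mod_eq_of_lt (by omega)
    rw [h1] at hv'
    rcases Nat.lt_or_ge (v + 1) (2 * m + 1) with hlt | hge
    · rw [Nat.mod_eq_of_lt hlt] at hv'
      omega
    · have : v + 1 = 2 * m + 1 := by omega
      rw [this, Nat.mod_self] at hv'
      omega

/-- ★ **At odd `L` a centre twist is a gauge transformation times the global centre flip**: for every configuration `U`,
`twist k negOne U` is gauge-equivalent to `U` with all direction-`k` links multiplied by `−1`. [folklore] -/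
theorem exists_gauge_twist_negOne_of_odd (hL : Odd L) (k : Fin 3) (U : GaugeConfig 3 L SU2) :
    ∃ g : Site 3 L → SU2, gaugeTransform g (twist k negOne U) = fun e => if e.2 = k then negOne * U e else U e := by
  classical
  -- the step character `χ(t) = −1` iff `t ∈ {2, 4, …}` (even residue, non-zero)
  set χ : ZMod L → SU2 := fun t => if t.val % 2 = 0 ∧ t ≠ 0 then negOne else 1 with hχ
  have hcen : ∀ t, χ t ∈ Subgroup.center SU2 := by
    intro t
    by_cases ht : t.val % 2 = 0 ∧ t ≠ 0
    · have : χ t = negOne := if_pos ht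
      rw [this]; exact negOne_mem_center
    · have : χ t = 1 := if_neg ht
      rw [this]; exact Subgroup.one_mem _
  refine ⟨fun x => χ (x k), ?_⟩
  funext e
  obtain ⟨x, i⟩ := e
  simp only [gaugeTransform, twist]
  by_cases hi : i = k
  · subst hi
    have hs : (x.shift i) i = x i + 1 := by simp [Site.shift]
    simp only [true_and, if_true, hs]
    have hv : (x i).val < L := ZMod.val_lt _
    have hv' : (x i + 1).val = ((x i).val + 1 % L) % L := by rw [ZMod.val_add, ZMod.val_one_eq_one_mod]
    have h0 : x i = 0 ↔ (x i).val = 0 := (ZMod.val_eq_zero (x i)).symm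
    have h0' : x i + 1 = 0 ↔ (x i + 1).val = 0 := (ZMod.val_eq_zero _).symm
    have hinv : (negOne : SU2)⁻¹ = negOne := inv_eq_of_mul_eq_one_right negOne_mul_negOne
    rcases parity_core hL hv hv' with ⟨hA, hB, hC⟩ | ⟨hA, hB, hC⟩ | ⟨hA, hB, hC⟩
    · have hB' : ¬ x i = 0 := fun h => hB (h0.mp h)
      have hA' : χ (x i) = negOne := if_pos ⟨hA.1, hB'⟩
      have hC' : χ (x i + 1) = 1 := if_neg fun h => hC ⟨h.1, fun h' => h.2 (h0'.mpr h')⟩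
      rw [hA', if_neg hB', hC', inv_one, mul_one]
    · have hB' : x i = 0 := h0.mpr hB
      have hA' : χ (x i) = 1 := if_neg fun h => h.2 hB'
      have hC' : χ (x i + 1) = 1 := if_neg fun h => hC ⟨h.1, fun h' => h.2 (h0'.mpr h')⟩
      rw [hA', if_pos hB', hC', inv_one, mul_one, one_mul]
    · have hB' : ¬ x i = 0 := fun h => hB (h0.mp h)
      have hA' : χ (x i) = 1 := if_neg fun h => hA ⟨h.1, hB⟩
      have hC' : χ (x i + 1) = negOne := if_pos ⟨hC.1, fun h => hC.2 (h0'.mp h)⟩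
      rw [hA', if_neg hB', hC', one_mul, hinv, ← negOne_mul_comm]
  · have hik : ¬ (i = k) := hi
    have hs : (x.shift i) k = x k := by simp [Site.shift, Pi.single_eq_of_ne (Ne.symm hi)]
    simp only [hik, false_and, if_false, hs]
    rw [← Subgroup.mem_center_iff.mp (hcen (x k)) (U (x, i)), mul_inv_cancel_right]

/-- ★ **At odd `L` the R9 witness is EXACTLY gauge-equivalent to a constant configuration**: `twist 2 negOne (twoLinkCfg a b) = g⁻¹ · Const(a, b, −1)`.
So the distance «modulo gauge to the constants» of the witness of `R9.constProximity_rpow_false` vanishes at odd `L`: `Even L` there is load-bearing. [folklore] -/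
theorem twist_twoLinkCfg_gauge_const_of_odd (hL : Odd L) (a b : SU2) :
    ∃ (g : Site 3 L → SU2) (c : Fin 3 → SU2), ∀ e : Edge 3 L, gaugeTransform g (twist 2 negOne (twoLinkCfg a b)) e = c e.2 := by
  obtain ⟨g, hg⟩ := exists_gauge_twist_negOne_of_odd hL 2 (twoLinkCfg a b)
  refine ⟨g, fun i => if i = 2 then negOne else if i = 0 then a else b, fun e => ?_⟩
  rw [hg]
  obtain ⟨x, i⟩ := e
  fin_cases i <;> simp [twoLinkCfg]

/-- Metric form: at odd `L`, for every `a b` there are a gauge `g` and constants `c` with ALL link distances ZERO — in particular within `C · S^α` for every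
`C ≥ 0`, every `α`: the R9 witness family cannot refute constant-proximity at odd `L`. [folklore] -/
theorem twist_twoLinkCfg_constProximity_of_odd (hL : Odd L) (a b : SU2) {C α : ℝ} (hC : 0 ≤ C) :
    ∃ (g : Site 3 L → SU2) (c : Fin 3 → SU2), ∀ e : Edge 3 L,
      frobNorm (((gaugeTransform g (twist 2 negOne (twoLinkCfg a b)) e : SU2) : Matrix (Fin 2) (Fin 2) ℂ) - ((c e.2 : SU2) : Matrix (Fin 2) (Fin 2) ℂ))
        ≤ C * wilsonAction su2Rep (twist 2 negOne (twoLinkCfg a b : GaugeConfig 3 L SU2)) ^ α := by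
  obtain ⟨g, c, h⟩ := twist_twoLinkCfg_gauge_const_of_odd hL a b
  refine ⟨g, c, fun e => ?_⟩
  rw [h e, sub_self, frobNorm_zero]
  exact mul_nonneg hC (Real.rpow_nonneg (wilsonAction_su2_nonneg_lat _) _)

end Summit.QuantumFields.YangMills.Theorems.TwistedTraceScaling.Negative.R9

end
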